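import Literature.Probability.Percolation.OneArmHullAvoidsOrigin
import Literature.Analysis.Complex.ConformalRadiusSchwarzDeficit
import HarnessLib

/-!
# LSW's Lemma 2.3 with two arms: the renewal hypotheses from arc couplings with tail exponent `γ > 1/2` (proofs only)

Topic `Probability/Percolation`; family `crit-perc`. Def-free, fact-free sequel of
`OneArmNeumannEstimate.lean`, `OneArmNeumannCoupling.lean`, `OneArmHullAvoidsOrigin.lean` and
`Literature/Analysis/Complex/ConformalRadiusSchwarzDeficit.lean`, about the named facts
`LawlerSchrammWerner2002_hittingPDE`, `LawlerSchrammWerner2002_scalingLimitExponent` (LSW Thm. 1.2)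
and `oneArm_exponent` (LSW Thm. 1.1) of Lawler–Schramm–Werner, *One-arm exponent for critical 2D
percolation*, Electron. J. Probab. **7** (2002), paper no. 2.

`renewal_hypotheses_of_arcCoupling` (`OneArmNeumannCoupling.lean`) derives the two hypotheses of
the identification theorem `lswHit_two_pi_eq_measureReal_of_renewal` from couplings `μ_θ` of the
arc hulls `(K_θ, K_{2π})` carrying LSW's (2.10) and the tail (2.14)
`μ_θ{K_{2π} ⊄ K_θ ∪ B̄(1, r)} ≤ c ((2π - θ)/r)^γ` with `γ > 1` — the exponent `1 + α` of LSW's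
THREE-arm bound (2.13) — because the deficit bound used there (`ConformalRadiusKoebeDeficit`,
Koebe distortion) has exponent `1/2` in `r`. With the LINEAR deficit of
`ConformalRadiusSchwarzDeficit` (`(1 - r) 𝔯(K) ≤ 𝔯(K ∪ K')` for `K' ⊆ B̄(ζ, r)`, `|ζ| ≥ 1`, by the
Schwarz lemma alone) the balance `2r + c (ε/r)^γ` at `r = ε^{γ/(1+γ)}` is `(2 + c) ε^{γ/(1+γ)}`,
and `γ/(1 + γ) > 1/3` iff `γ > 1/2`: **a tail exponent `γ > 1/2` suffices**, so the half-plane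
TWO-arm bound (exponent `1`; Nolin 2008, `Nolin2008_halfPlane_twoArm_holds`) can replace (2.13) in
the percolation estimate (2.14). The tail may moreover be localised at any point `ζ` with `|ζ| ≥ 1`
(the discrete arc hulls of the tree are anchored where the tangent to the circle is a lattice line).

* `intervalIntegral_measureReal_sub_le_of_tail_linear` — for random variables `0 < X₂ ≤ X₁`,
  `uᵢ(s) = P[Xᵢ ≤ e^{-s}]`, `L ≤ 1`: if `P[X₁ > e^{-(a+1)} ∧ min{log X₁ - log X₂, 1} > 2r] ≤ c (ε/r)^γ`
  for all `r > 0` (`γ > 0`), then `∫_a^{a+L} (u₂ - u₁) ≤ (2 + c) ε^{γ/(1+γ)}`;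
* `eventually_window_sub_ge_of_tail_linear` — the weak Lemma 2.3 for a family of couplings with
  such tails, `γ > 1/2`: eventually as `θ ↑ 2π`,
  `∫₀ᴸ P_θ[X₁^θ ≤ e^{-(t+r)}] dr - ∫₀ᴸ w(t + r) dr ≥ -ε' (2π - θ)^{1/3}`;
* `renewal_hypotheses_of_arcCoupling_linear` — for a probability measure `ν` on non-empty compacts
  with `𝔯 > 0` a.s. and couplings `μ_θ` (`θ ∈ (0, 2π)`) with second marginal `ν`, `K_θ ⊆ K_{2π}`
  a.s., (2.10) for the first marginal, and the tail `μ_θ{K_{2π} ⊄ K_θ ∪ B̄(ζ, r)} ≤ c ((2π - θ)/r)^γ`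
  for `θ` near `2π`, `r > 0`, some `|ζ| ≥ 1` and `γ > 1/2`: BOTH hypotheses of
  `lswHit_two_pi_eq_measureReal_of_renewal` hold; `lswHit_two_pi_eq_measureReal_of_arcCoupling_linear`;
* `oneArm_exponent_of_subseqArcCoupling_linear`, `oneArm_exponent_of_subseqArcCoupling_linear'` —
  the named fact, LSW Thm. 1.2 and Thm. 1.1 from such couplings at every subsequential weak limit
  of `lswLaw` (the primed form with `𝔯 > 0` a.s. discharged by RSW,
  `ae_conformalRadius_pos_of_subseqLimit`).

No new definitions, no named facts.

## References

* G. F. Lawler, O. Schramm, W. Werner, *One-arm exponent for critical 2D percolation*, Electron.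
  J. Probab. 7 (2002), no. 2: Thm. 2.1, (2.2), (2.10), Lemma 2.3 (2.12)–(2.16), proof of Thm. 1.2
  (pp. 3–8) [LawlerSchrammWernerEJP2002].
* P. Nolin, *Near-critical percolation in two dimensions*, Electron. J. Probab. 13 (2008),
  Thm. 24 (i) (half-plane two-arm exponent `1`) [Nolin2008].

## Mathlib / tree

Tree: `intervalIntegral_measureReal_sub_le_indicator`, `integral_le_add_measureReal_lt`,
`eventually_le_mul_rpow_one_third`, `antitone_measureReal_le_exp_neg` (`OneArmNeumannEstimate`),
`measurable_conformalRadius_nonemptyCompacts`, `oneArm_exponent_of_subseqRenewal`,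
`lswHit_two_pi_eq_measureReal_of_renewal`, `renewalST_window`, `measurable_bottomDatum`,
`bottomDatum_mem_Icc`, `ae_conformalRadius_pos_of_subseqLimit` (`OneArmNeumannCoupling`,
`OneArmTraceIdentification`, `OneArmRenewal`, `OneArmHullAvoidsOrigin`),
`conformalRadius_deficit_of_subset_union` (`ConformalRadiusSchwarzDeficit`). Mathlib:
`Real.rpow_sub`, `Real.rpow_mul`, `ae_of_ae_map`, `measureReal_congr`, `map_measureReal_apply`.
-/

noncomputable section

open MeasureTheory Filter Topology Set Metric TopologicalSpace
open scoped NNReal ENNReal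

namespace Literature.Probability.Percolation

open Literature.Analysis.Complex Literature.Probability.RandomPlanarGeometry
  Literature.Probability.RandomPlanarGeometry.RadialLoewner

section Bridge

variable {Ω : Type*} [MeasurableSpace Ω] (P : Measure Ω) [IsProbabilityMeasure P] {X₁ X₂ : Ω → ℝ}

/-- **Window differences from a tail bound, linear deficit.** For random variables `0 < X₂ ≤ X₁`,
`uᵢ(s) = P[Xᵢ ≤ e^{-s}]`, `L ≤ 1`, `ρ₀ = e^{-(a+1)}`, and constants `c`, `γ > 0`, `ε > 0`: if for
all `r > 0`, `P[X₁ > ρ₀ ∧ min{log X₁ - log X₂, 1} > 2r] ≤ c (ε/r)^γ`, then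
`∫_a^{a+L} (u₂ - u₁) ≤ (2 + c) ε^{γ/(1+γ)}`. In LSW (`X₁ = 𝔯(θ)`, `X₂ = 𝔯(2π)`, `ε = 2π - θ`) the
event is contained in `{Q' ⊄ B̄(ζ, r)}` by the linear deficit bound of
`ConformalRadiusSchwarzDeficit`, and its probability is (2.14); `r = ε^{γ/(1+γ)}` balances the two
terms. [cite: LawlerSchrammWernerEJP2002, proof of Lemma 2.3, (2.14)–(2.16) (p. 7)] -/
theorem intervalIntegral_measureReal_sub_le_of_tail_linear (hX₁ : Measurable X₁) (hX₂ : Measurable X₂)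
    (hpos : ∀ ω, 0 < X₂ ω) (hle : ∀ ω, X₂ ω ≤ X₁ ω) (a : ℝ) {L : ℝ} (hL1 : L ≤ 1)
    {c γ ε : ℝ} (hγ : 0 < γ) (hε : 0 < ε)
    (htail : ∀ r : ℝ, 0 < r →
      P.real {ω | Real.exp (-(a + 1)) < X₁ ω ∧
        2 * r < min (Real.log (X₁ ω) - Real.log (X₂ ω)) 1} ≤ c * (ε / r) ^ γ) :
    ∫ s in a..a + L, (P.real {ω | X₂ ω ≤ Real.exp (-s)} - P.real {ω | X₁ ω ≤ Real.exp (-s)}) ≤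
      (2 + c) * ε ^ (γ / (1 + γ)) := by
  set ρ₀ : ℝ := Real.exp (-(a + 1)) with hρ₀
  set p : ℝ := γ / (1 + γ) with hp
  have h1γ : 0 < 1 + γ := by linarith
  set r : ℝ := ε ^ p with hr
  have hrpos : 0 < r := Real.rpow_pos_of_pos hε _
  -- the tail term at `r = ε^p`: `(ε/r)^γ = ε^p`
  have hratio : (ε / r) ^ γ = ε ^ p := by
    rw [hr, show ε / ε ^ p = ε ^ (1 - p) by rw [Real.rpow_sub hε, Real.rpow_one],
      ← Real.rpow_mul hε.le]
    congr 1
    rw [hp]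
    field_simp
    ring
  -- the restricted defect `f`
  set f : Ω → ℝ := {ω | ρ₀ < X₁ ω}.indicator
    (fun ω ↦ min (Real.log (X₁ ω) - Real.log (X₂ ω)) 1) with hf
  have hmin0 : ∀ ω, 0 ≤ min (Real.log (X₁ ω) - Real.log (X₂ ω)) 1 := fun ω ↦
    le_min (by linarith [Real.log_le_log (hpos ω) (hle ω)]) zero_le_one
  have hf0 : ∀ ω, 0 ≤ f ω := fun ω ↦ by
    simp only [hf, indicator]
    split_ifs
    · exact hmin0 ω
    · exact le_rfl
  have hf1 : ∀ ω, f ω ≤ 1 := fun ω ↦ by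
    simp only [hf, indicator]
    split_ifs
    · exact min_le_right _ _
    · exact zero_le_one
  have hfm : Measurable f :=
    (((Real.measurable_log.comp hX₁).sub (Real.measurable_log.comp hX₂)).min measurable_const).indicator
      (measurableSet_lt measurable_const hX₁)
  set b : ℝ := 2 * r with hb
  have hb0 : 0 ≤ b := by positivity
  have hkey : {ω | b < f ω} = {ω | ρ₀ < X₁ ω ∧ b < min (Real.log (X₁ ω) - Real.log (X₂ ω)) 1} := by
    ext ω
    simp only [mem_setOf_eq, hf, indicator]
    split_ifs with h
    · exact ⟨fun hlt ↦ ⟨h, hlt⟩, fun hh ↦ hh.2⟩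
    · constructor
      · intro hlt; linarith
      · intro hh; exact absurd hh.1 h
  have hE := integral_le_add_measureReal_lt P hfm hf0 hf1 hb0
  rw [hkey] at hE
  have hT := htail r hrpos
  calc ∫ s in a..a + L, (P.real {ω | X₂ ω ≤ Real.exp (-s)} - P.real {ω | X₁ ω ≤ Real.exp (-s)})
      ≤ ∫ ω, f ω ∂P := intervalIntegral_measureReal_sub_le_indicator P hX₁ hX₂ hpos hle a hL1
    _ ≤ b + P.real {ω | ρ₀ < X₁ ω ∧ b < min (Real.log (X₁ ω) - Real.log (X₂ ω)) 1} := hE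
    _ ≤ b + c * (ε / r) ^ γ := by linarith
    _ = (2 + c) * ε ^ p := by rw [hb, hratio, hr]; ring

end Bridge

section Family

variable {Ω : Type*} [MeasurableSpace Ω]

/-- **The weak Lemma 2.3 for a family of couplings, tail exponent `γ > 1/2`.** Let `P_θ` (`θ ∈ ℝ`)
be probability measures on one measurable space, `X₁^θ, X₂ : Ω → ℝ` measurable with
`0 < X₂ ≤ X₁^θ`, the law of `X₂` the same under every `P_θ`: `P_θ[X₂ ≤ e^{-s}] = w(s)`. If for some
`θ₁ < 2π`, `c` and `γ > 1/2`, for all `θ ∈ (θ₁, 2π)`, `ρ₀ > 0`, `r > 0`: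
`P_θ[X₁^θ > ρ₀ ∧ min{log X₁^θ - log X₂, 1} > 2r] ≤ c ((2π - θ)/r)^γ`, then for every `L ≤ 1`, `t`
and `ε' > 0`, eventually as `θ ↑ 2π`,
`-ε' (2π - θ)^{1/3} ≤ ∫₀ᴸ P_θ[X₁^θ ≤ e^{-(t+r)}] dr - ∫₀ᴸ w(t + r) dr` (`γ/(1+γ) > 1/3`).
[cite: LawlerSchrammWernerEJP2002, Lemma 2.3 (2.12) and its proof (pp. 6–7)] -/
theorem eventually_window_sub_ge_of_tail_linear (P : ℝ → Measure Ω) [∀ θ, IsProbabilityMeasure (P θ)]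
    {X₁ : ℝ → Ω → ℝ} {X₂ : Ω → ℝ} (hX₁ : ∀ θ, Measurable (X₁ θ)) (hX₂ : Measurable X₂)
    (hpos : ∀ ω, 0 < X₂ ω) (hle : ∀ θ ω, X₂ ω ≤ X₁ θ ω) {w : ℝ → ℝ}
    (hw : ∀ θ s, (P θ).real {ω | X₂ ω ≤ Real.exp (-s)} = w s)
    {θ₁ c γ : ℝ} (hθ₁ : θ₁ < 2 * Real.pi) (hγ : 1 / 2 < γ)
    (htail : ∀ θ ∈ Ioo θ₁ (2 * Real.pi), ∀ ρ₀ : ℝ, 0 < ρ₀ → ∀ r : ℝ, 0 < r →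
      (P θ).real {ω | ρ₀ < X₁ θ ω ∧ 2 * r < min (Real.log (X₁ θ ω) - Real.log (X₂ ω)) 1} ≤
        c * ((2 * Real.pi - θ) / r) ^ γ)
    {L : ℝ} (hL1 : L ≤ 1) (t : ℝ) {ε' : ℝ} (hε' : 0 < ε') :
    ∀ᶠ θ in 𝓝[<] (2 * Real.pi),
      -(ε' * (2 * Real.pi - θ) ^ (1 / 3 : ℝ)) ≤
        (∫ r in (0 : ℝ)..L, (P θ).real {ω | X₁ θ ω ≤ Real.exp (-(t + r))}) -
          ∫ r in (0 : ℝ)..L, w (t + r) := by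
  set ρ₀ : ℝ := Real.exp (-(t + 1)) with hρ₀
  have hρ₀pos : 0 < ρ₀ := Real.exp_pos _
  set C : ℝ := 2 + c with hC
  have hγ0 : 0 < γ := by linarith
  have hp : (1 / 3 : ℝ) < γ / (1 + γ) := by
    rw [div_lt_div_iff₀ (by norm_num) (by linarith)]
    linarith
  -- the bound `∫_t^{t+L} (u₂ - u₁^θ) ≤ C (2π - θ)^{γ/(1+γ)}` on `(θ₁, 2π)`
  have hF : ∀ᶠ θ in 𝓝[<] (2 * Real.pi),
      (∫ s in t..t + L, ((P θ).real {ω | X₂ ω ≤ Real.exp (-s)} -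
        (P θ).real {ω | X₁ θ ω ≤ Real.exp (-s)})) ≤ C * (2 * Real.pi - θ) ^ (γ / (1 + γ)) := by
    have hmem : Ioo θ₁ (2 * Real.pi) ∈ 𝓝[<] (2 * Real.pi) := Ioo_mem_nhdsLT hθ₁
    filter_upwards [hmem] with θ hθ
    have hεθ : 0 < 2 * Real.pi - θ := by linarith [hθ.2]
    exact intervalIntegral_measureReal_sub_le_of_tail_linear (P θ) (hX₁ θ) hX₂ hpos (hle θ) t hL1
      hγ0 hεθ (fun r hr ↦ htail θ hθ ρ₀ hρ₀pos r hr)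
  have hev := eventually_le_mul_rpow_one_third hp hF hε'
  filter_upwards [hev] with θ hθ
  -- rewrite the window integrals as `∫_t^{t+L}`
  have hsub1 : (∫ r in (0 : ℝ)..L, (P θ).real {ω | X₁ θ ω ≤ Real.exp (-(t + r))}) =
      ∫ s in t..t + L, (P θ).real {ω | X₁ θ ω ≤ Real.exp (-s)} := by
    rw [intervalIntegral.integral_comp_add_left (fun s ↦ (P θ).real {ω | X₁ θ ω ≤ Real.exp (-s)}) t,
      add_zero]
  have hsub2 : (∫ r in (0 : ℝ)..L, w (t + r)) = ∫ s in t..t + L, (P θ).real {ω | X₂ ω ≤ Real.exp (-s)} := by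
    rw [intervalIntegral.integral_comp_add_left (fun s ↦ w s) t, add_zero]
    exact intervalIntegral.integral_congr fun s _ ↦ (hw θ s).symm
  have hi₁ : IntervalIntegrable (fun s ↦ (P θ).real {ω | X₁ θ ω ≤ Real.exp (-s)}) volume t (t + L) :=
    (antitone_measureReal_le_exp_neg (P θ) (X₁ θ)).intervalIntegrable
  have hi₂ : IntervalIntegrable (fun s ↦ (P θ).real {ω | X₂ ω ≤ Real.exp (-s)}) volume t (t + L) :=
    (antitone_measureReal_le_exp_neg (P θ) X₂).intervalIntegrable
  rw [hsub1, hsub2, ← intervalIntegral.integral_sub hi₁ hi₂]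
  have : ∫ s in t..t + L, ((P θ).real {ω | X₁ θ ω ≤ Real.exp (-s)} - (P θ).real {ω | X₂ ω ≤ Real.exp (-s)}) =
      -∫ s in t..t + L, ((P θ).real {ω | X₂ ω ≤ Real.exp (-s)} - (P θ).real {ω | X₁ θ ω ≤ Real.exp (-s)}) := by
    rw [← intervalIntegral.integral_neg]
    exact intervalIntegral.integral_congr fun s _ ↦ by ring
  rw [this]
  linarith

end Family

section Coupling

variable (ν : ProbabilityMeasure (NonemptyCompacts ℂ))
  (μ : ℝ → ProbabilityMeasure (NonemptyCompacts ℂ × NonemptyCompacts ℂ))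

/-- **The renewal hypotheses from arc couplings, tail exponent `γ > 1/2` (LSW (2.10) + Lemma 2.3
with two arms).** Let `ν` be a probability measure on non-empty compacts with `𝔯(K) > 0` for
`ν`-a.e. `K`, `w(s) = ν{K | 𝔯(K) ≤ e^{-s}}`, and for `θ ∈ (0, 2π)` let `μ_θ` be probability measures
on pairs `(K_θ, K_{2π})` with: second marginal `ν`; `K_θ ⊆ K_{2π}` a.s.; **(2.10)**
`μ_θ{𝔯(K_θ) ≤ e^{-s}} = renewalST 6 1_{≤0} w θ s` for all `s`; and for some `|ζ| ≥ 1`, `θ₁ < 2π`,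
`c`, `γ > 1/2`, the **tail** `μ_θ{K_{2π} ⊄ K_θ ∪ B̄(ζ, r)} ≤ c ((2π - θ)/r)^γ` for `θ ∈ (θ₁, 2π)`,
`r > 0`. Then (i) `renewalST 6 1_{≤0} w θ s ≤ w(s)` on `(0, 2π) × ℝ`, and (ii) for `L ∈ (0, 1)`,
`t > 0`, `ε' > 0`, eventually as `θ ↑ 2π`,
`renewalST 6 (win_L 1_{≤0}) (win_L w) θ t - win_L w (t) ≥ -ε' (2π - θ)^{1/3}` — the hypotheses of
`lswHit_two_pi_eq_measureReal_of_renewal`. Same proof as `renewal_hypotheses_of_arcCoupling`, with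
the linear deficit `min{log 𝔯(K_θ) - log 𝔯(K_{2π}), 1} ≤ 2r` on `{K_{2π} ⊆ K_θ ∪ B̄(ζ, r)}`
(`conformalRadius_deficit_of_subset_union`).
[cite: LawlerSchrammWernerEJP2002, §2: (2.10), Lemma 2.3 (2.12)–(2.16) (pp. 5–7)] -/
theorem renewal_hypotheses_of_arcCoupling_linear
    (hpos : ∀ᵐ K ∂(ν : Measure (NonemptyCompacts ℂ)), 0 < conformalRadius ((K : NonemptyCompacts ℂ) : Set ℂ))
    (hsnd : ∀ θ ∈ Ioo 0 (2 * Real.pi),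
      (μ θ : Measure (NonemptyCompacts ℂ × NonemptyCompacts ℂ)).map Prod.snd = ν)
    (hsub : ∀ θ ∈ Ioo 0 (2 * Real.pi), ∀ᵐ p ∂(μ θ : Measure (NonemptyCompacts ℂ × NonemptyCompacts ℂ)),
      ((p.1 : NonemptyCompacts ℂ) : Set ℂ) ⊆ (p.2 : Set ℂ))
    (h210 : ∀ θ ∈ Ioo 0 (2 * Real.pi), ∀ s : ℝ,
      (μ θ : Measure (NonemptyCompacts ℂ × NonemptyCompacts ℂ)).real
          {p | conformalRadius ((p.1 : NonemptyCompacts ℂ) : Set ℂ) ≤ Real.exp (-s)} =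
        renewalST 6 bottomDatum (fun s ↦ (ν : Measure (NonemptyCompacts ℂ)).real
          {K | conformalRadius (K : Set ℂ) ≤ Real.exp (-s)}) θ s)
    {ζ : ℂ} (hζ : 1 ≤ ‖ζ‖) {θ₁ c γ : ℝ} (hθ₁ : θ₁ < 2 * Real.pi) (hγ : 1 / 2 < γ)
    (htail : ∀ θ ∈ Ioo θ₁ (2 * Real.pi), ∀ r : ℝ, 0 < r →
      (μ θ : Measure (NonemptyCompacts ℂ × NonemptyCompacts ℂ)).real
          {p | ¬ (((p.2 : NonemptyCompacts ℂ) : Set ℂ) ⊆ (p.1 : Set ℂ) ∪ closedBall ζ r)} ≤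
        c * ((2 * Real.pi - θ) / r) ^ γ) :
    (∀ θ ∈ Ioo 0 (2 * Real.pi), ∀ s : ℝ,
      renewalST 6 bottomDatum (fun s ↦ (ν : Measure (NonemptyCompacts ℂ)).real
        {K | conformalRadius (K : Set ℂ) ≤ Real.exp (-s)}) θ s ≤
        (ν : Measure (NonemptyCompacts ℂ)).real {K | conformalRadius (K : Set ℂ) ≤ Real.exp (-s)}) ∧
    ∀ L ∈ Ioo (0 : ℝ) 1, ∀ t : ℝ, 0 < t → ∀ ε : ℝ, 0 < ε → ∀ᶠ θ in 𝓝[<] (2 * Real.pi),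
      -(ε * (2 * Real.pi - θ) ^ (1 / 3 : ℝ)) ≤
        renewalST 6 (fun s ↦ ∫ r in (0 : ℝ)..L, bottomDatum (s + r))
          (fun s ↦ ∫ r in (0 : ℝ)..L, (ν : Measure (NonemptyCompacts ℂ)).real
            {K | conformalRadius (K : Set ℂ) ≤ Real.exp (-(s + r))}) θ t -
        ∫ r in (0 : ℝ)..L, (ν : Measure (NonemptyCompacts ℂ)).real
            {K | conformalRadius (K : Set ℂ) ≤ Real.exp (-(t + r))} := by
  -- notation
  set w : ℝ → ℝ := fun s ↦ (ν : Measure (NonemptyCompacts ℂ)).real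
    {K | conformalRadius (K : Set ℂ) ≤ Real.exp (-s)} with hwdef
  set R₁ : NonemptyCompacts ℂ × NonemptyCompacts ℂ → ℝ := fun p ↦ conformalRadius ((p.1 : NonemptyCompacts ℂ) : Set ℂ)
    with hR₁
  set R₂ : NonemptyCompacts ℂ × NonemptyCompacts ℂ → ℝ := fun p ↦ conformalRadius ((p.2 : NonemptyCompacts ℂ) : Set ℂ)
    with hR₂
  have hR₁m : Measurable R₁ := measurable_conformalRadius_nonemptyCompacts.comp measurable_fst
  have hR₂m : Measurable R₂ := measurable_conformalRadius_nonemptyCompacts.comp measurable_snd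
  -- the patched variables `0 < X₂ ≤ X₁`, a.s. equal to `R₂, R₁`
  set X₂ : NonemptyCompacts ℂ × NonemptyCompacts ℂ → ℝ := fun p ↦ if 0 < R₂ p then R₂ p else 1 with hX₂
  set X₁ : NonemptyCompacts ℂ × NonemptyCompacts ℂ → ℝ := fun p ↦ if 0 < R₂ p then max (R₁ p) (R₂ p) else 1
    with hX₁
  have hmspos : MeasurableSet {p : NonemptyCompacts ℂ × NonemptyCompacts ℂ | 0 < R₂ p} :=
    measurableSet_lt measurable_const hR₂m
  have hX₂m : Measurable X₂ := Measurable.ite hmspos hR₂m measurable_const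
  have hX₁m : Measurable X₁ := Measurable.ite hmspos (hR₁m.max hR₂m) measurable_const
  have hX₂pos : ∀ p, 0 < X₂ p := fun p ↦ by
    simp only [hX₂]; split_ifs with h
    · exact h
    · exact one_pos
  have hX₂le : ∀ p, X₂ p ≤ X₁ p := fun p ↦ by
    simp only [hX₂, hX₁]; split_ifs
    · exact le_max_right _ _
    · exact le_rfl
  -- the good set and its full measure
  have hgood : ∀ θ ∈ Ioo 0 (2 * Real.pi), ∀ᵐ p ∂(μ θ : Measure (NonemptyCompacts ℂ × NonemptyCompacts ℂ)),
      ((p.1 : NonemptyCompacts ℂ) : Set ℂ) ⊆ (p.2 : Set ℂ) ∧ 0 < R₂ p := by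
    intro θ hθ
    have h2 : ∀ᵐ p ∂(μ θ : Measure (NonemptyCompacts ℂ × NonemptyCompacts ℂ)), 0 < R₂ p := by
      have hmap : ∀ᵐ K ∂((μ θ : Measure (NonemptyCompacts ℂ × NonemptyCompacts ℂ)).map Prod.snd),
          0 < conformalRadius ((K : NonemptyCompacts ℂ) : Set ℂ) := by rw [hsnd θ hθ]; exact hpos
      exact ae_of_ae_map measurable_snd.aemeasurable hmap
    filter_upwards [hsub θ hθ, h2] with p h1 h2 using ⟨h1, h2⟩
  have hX_good : ∀ p : NonemptyCompacts ℂ × NonemptyCompacts ℂ,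
      (((p.1 : NonemptyCompacts ℂ) : Set ℂ) ⊆ (p.2 : Set ℂ) ∧ 0 < R₂ p) → X₁ p = R₁ p ∧ X₂ p = R₂ p := by
    rintro p ⟨hsub', hpos'⟩
    have hmono : R₂ p ≤ R₁ p := conformalRadius_mono hsub'
    refine ⟨?_, ?_⟩
    · simp only [hX₁, if_pos hpos', max_eq_left hmono]
    · simp only [hX₂, if_pos hpos']
  -- a.s. equality of the level sets
  have hlevel : ∀ θ ∈ Ioo 0 (2 * Real.pi), ∀ s : ℝ,
      ({p | X₁ p ≤ Real.exp (-s)} =ᵐ[(μ θ : Measure (NonemptyCompacts ℂ × NonemptyCompacts ℂ))]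
        {p | R₁ p ≤ Real.exp (-s)}) ∧
      ({p | X₂ p ≤ Real.exp (-s)} =ᵐ[(μ θ : Measure (NonemptyCompacts ℂ × NonemptyCompacts ℂ))]
        {p | R₂ p ≤ Real.exp (-s)}) := by
    intro θ hθ s
    constructor
    · filter_upwards [hgood θ hθ] with p hp
      have := (hX_good p hp).1
      show (p ∈ {p | X₁ p ≤ Real.exp (-s)}) = (p ∈ {p | R₁ p ≤ Real.exp (-s)})
      simp only [mem_setOf_eq, this]
    · filter_upwards [hgood θ hθ] with p hp
      have := (hX_good p hp).2
      show (p ∈ {p | X₂ p ≤ Real.exp (-s)}) = (p ∈ {p | R₂ p ≤ Real.exp (-s)})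
      simp only [mem_setOf_eq, this]
  -- the laws: `μ_θ{X₂ ≤ e^{-s}} = w s`, `μ_θ{X₁ ≤ e^{-s}} = renewalST … θ s`
  have hlawX₂ : ∀ θ ∈ Ioo 0 (2 * Real.pi), ∀ s : ℝ,
      (μ θ : Measure (NonemptyCompacts ℂ × NonemptyCompacts ℂ)).real {p | X₂ p ≤ Real.exp (-s)} = w s := by
    intro θ hθ s
    rw [measureReal_congr (hlevel θ hθ s).2]
    have hS : MeasurableSet {K : NonemptyCompacts ℂ | conformalRadius (K : Set ℂ) ≤ Real.exp (-s)} :=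
      measurableSet_le measurable_conformalRadius_nonemptyCompacts measurable_const
    have := map_measureReal_apply (μ := (μ θ : Measure (NonemptyCompacts ℂ × NonemptyCompacts ℂ)))
      measurable_snd hS
    rw [hsnd θ hθ] at this
    simp only [hwdef]
    rw [this]
    rfl
  have hlawX₁ : ∀ θ ∈ Ioo 0 (2 * Real.pi), ∀ s : ℝ,
      (μ θ : Measure (NonemptyCompacts ℂ × NonemptyCompacts ℂ)).real {p | X₁ p ≤ Real.exp (-s)} =
        renewalST 6 bottomDatum w θ s := by
    intro θ hθ s
    rw [measureReal_congr (hlevel θ hθ s).1]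
    exact h210 θ hθ s
  -- (i) domination
  have hdom : ∀ θ ∈ Ioo 0 (2 * Real.pi), ∀ s : ℝ, renewalST 6 bottomDatum w θ s ≤ w s := by
    intro θ hθ s
    rw [← hlawX₁ θ hθ s, ← hlawX₂ θ hθ s]
    exact measureReal_mono (fun p (hp : X₁ p ≤ Real.exp (-s)) ↦ (hX₂le p).trans hp)
  refine ⟨hdom, ?_⟩
  -- (ii) flatness from below
  intro L hL t ht ε hε
  -- the tail at the level of `X₁, X₂`
  set θ₂ : ℝ := max θ₁ Real.pi with hθ₂
  have hθ₂lt : θ₂ < 2 * Real.pi := max_lt hθ₁ (by linarith [Real.pi_pos])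
  have hθ₂sub : Ioo θ₂ (2 * Real.pi) ⊆ Ioo 0 (2 * Real.pi) := fun θ hθ ↦
    ⟨(Real.pi_pos.trans_le (le_max_right θ₁ Real.pi)).trans hθ.1, hθ.2⟩
  have htailX : ∀ θ ∈ Ioo θ₂ (2 * Real.pi), ∀ ρ₀ : ℝ, 0 < ρ₀ → ∀ r : ℝ, 0 < r →
      (μ θ : Measure (NonemptyCompacts ℂ × NonemptyCompacts ℂ)).real {p | ρ₀ < X₁ p ∧
        2 * r < min (Real.log (X₁ p) - Real.log (X₂ p)) 1} ≤
        c * ((2 * Real.pi - θ) / r) ^ γ := by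
    intro θ hθ ρ₀ hρ₀ r hr
    have hθ' : θ ∈ Ioo 0 (2 * Real.pi) := hθ₂sub hθ
    have hθ'' : θ ∈ Ioo θ₁ (2 * Real.pi) := ⟨(le_max_left _ _).trans_lt hθ.1, hθ.2⟩
    set S := {p : NonemptyCompacts ℂ × NonemptyCompacts ℂ | ρ₀ < X₁ p ∧
      2 * r < min (Real.log (X₁ p) - Real.log (X₂ p)) 1} with hSdef
    set T := {p : NonemptyCompacts ℂ × NonemptyCompacts ℂ |
      ¬ (((p.2 : NonemptyCompacts ℂ) : Set ℂ) ⊆ (p.1 : Set ℂ) ∪ closedBall ζ r)} with hTdef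
    set G := {p : NonemptyCompacts ℂ × NonemptyCompacts ℂ |
      ((p.1 : NonemptyCompacts ℂ) : Set ℂ) ⊆ (p.2 : Set ℂ) ∧ 0 < R₂ p} with hGdef
    have hSTG : S ⊆ T ∪ Gᶜ := by
      intro p hp
      by_cases hG : p ∈ G
      · left
        intro hcontra
        obtain ⟨h1, h2⟩ := hX_good p hG
        rw [hSdef, mem_setOf_eq, h1, h2] at hp
        have hR₁pos : 0 < R₁ p := hρ₀.trans hp.1
        have := (conformalRadius_deficit_of_subset_union hζ hr.le hG.1 hcontra).2.2 hR₁pos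
        linarith [hp.2]
      · right; exact hG
    have hGc : (μ θ : Measure (NonemptyCompacts ℂ × NonemptyCompacts ℂ)).real Gᶜ = 0 := by
      have h0 : (μ θ : Measure (NonemptyCompacts ℂ × NonemptyCompacts ℂ)) Gᶜ = 0 := by
        have := hgood θ hθ'
        rw [ae_iff] at this
        rw [hGdef, compl_setOf]
        exact this
      simp [Measure.real, h0]
    calc (μ θ : Measure (NonemptyCompacts ℂ × NonemptyCompacts ℂ)).real S
        ≤ (μ θ : Measure (NonemptyCompacts ℂ × NonemptyCompacts ℂ)).real (T ∪ Gᶜ) := measureReal_mono hSTG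
      _ ≤ (μ θ : Measure (NonemptyCompacts ℂ × NonemptyCompacts ℂ)).real T +
            (μ θ : Measure (NonemptyCompacts ℂ × NonemptyCompacts ℂ)).real Gᶜ := measureReal_union_le _ _
      _ = (μ θ : Measure (NonemptyCompacts ℂ × NonemptyCompacts ℂ)).real T := by rw [hGc, add_zero]
      _ ≤ c * ((2 * Real.pi - θ) / r) ^ γ := htail θ hθ'' r hr
  -- the clamped family of measures (so that the law of `X₂` is `w` for every real parameter)
  set cl : ℝ → ℝ := fun θ ↦ if θ ∈ Ioo 0 (2 * Real.pi) then θ else Real.pi with hcl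
  have hcl_mem : ∀ θ, cl θ ∈ Ioo 0 (2 * Real.pi) := fun θ ↦ by
    simp only [hcl]; split_ifs with h
    · exact h
    · exact ⟨Real.pi_pos, by linarith [Real.pi_pos]⟩
  have hcl_id : ∀ θ ∈ Ioo 0 (2 * Real.pi), cl θ = θ := fun θ hθ ↦ by simp only [hcl, if_pos hθ]
  set P : ℝ → Measure (NonemptyCompacts ℂ × NonemptyCompacts ℂ) := fun θ ↦ (μ (cl θ) : Measure _) with hP
  haveI : ∀ θ, IsProbabilityMeasure (P θ) := fun θ ↦ by simp only [hP]; infer_instance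
  have hwP : ∀ θ s, (P θ).real {p | X₂ p ≤ Real.exp (-s)} = w s := fun θ s ↦ hlawX₂ (cl θ) (hcl_mem θ) s
  have htailP : ∀ θ ∈ Ioo θ₂ (2 * Real.pi), ∀ ρ₀ : ℝ, 0 < ρ₀ → ∀ r : ℝ, 0 < r →
      (P θ).real {p | ρ₀ < X₁ p ∧ 2 * r < min (Real.log (X₁ p) - Real.log (X₂ p)) 1} ≤
        c * ((2 * Real.pi - θ) / r) ^ γ := by
    intro θ hθ ρ₀ hρ₀ r hr
    simp only [hP, hcl_id θ (hθ₂sub hθ)]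
    exact htailX θ hθ ρ₀ hρ₀ r hr
  have hev := eventually_window_sub_ge_of_tail_linear P (X₁ := fun _ ↦ X₁) (fun _ ↦ hX₁m) hX₂m hX₂pos
    (fun _ ↦ hX₂le) hwP hθ₂lt hγ htailP hL.2.le t hε
  -- rewrite the renewal extension of the window averages as the window average of `μ_θ{X₁ ≤ e^{-·}}`
  have hwm : Measurable w := by
    refine Antitone.measurable fun a b hab ↦ ?_
    exact measureReal_mono fun K (hK : conformalRadius _ ≤ Real.exp (-b)) ↦
      hK.trans (Real.exp_le_exp.2 (neg_le_neg hab))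
  have hwb : ∀ s, |w s| ≤ 1 := fun s ↦ by
    rw [abs_of_nonneg measureReal_nonneg]; exact measureReal_le_one
  have hbb : ∀ s, |bottomDatum s| ≤ 1 := fun s ↦ by
    have := bottomDatum_mem_Icc s; rw [abs_of_nonneg this.1]; exact this.2
  have hmemI : Ioo 0 (2 * Real.pi) ∈ 𝓝[<] (2 * Real.pi) := Ioo_mem_nhdsLT (by linarith [Real.pi_pos])
  filter_upwards [hev, hmemI] with θ hθev hθI
  have hwin := renewalST_window (6 : ℝ≥0) measurable_bottomDatum hwm hbb hwb θ t hL.1.le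
  have hint : (∫ r in (0 : ℝ)..L, renewalST 6 bottomDatum w θ (t + r)) =
      ∫ r in (0 : ℝ)..L, (P θ).real {p | X₁ p ≤ Real.exp (-(t + r))} := by
    refine intervalIntegral.integral_congr fun r _ ↦ ?_
    simp only [hP, hcl_id θ hθI]
    exact (hlawX₁ θ hθI (t + r)).symm
  show -(ε * (2 * Real.pi - θ) ^ (1 / 3 : ℝ)) ≤
    renewalST 6 (fun s ↦ ∫ r in (0 : ℝ)..L, bottomDatum (s + r)) (fun s ↦ ∫ r in (0 : ℝ)..L, w (s + r)) θ t -
      ∫ r in (0 : ℝ)..L, w (t + r)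
  rw [hwin, hint]
  exact hθev

/-- **The trace identification from arc couplings, tail exponent `γ > 1/2`**: under the hypotheses
of `renewal_hypotheses_of_arcCoupling_linear`, `u(2π, t) = ν{K | 𝔯(K) ≤ e^{-t}}` for all `t > 0`
(`u = lswHit 6`; `lswHit_two_pi_eq_measureReal_of_renewal`).
[cite: LawlerSchrammWernerEJP2002, §2: Thm. 2.1, (2.10), Lemma 2.2, Lemma 2.3] -/
theorem lswHit_two_pi_eq_measureReal_of_arcCoupling_linear
    (hpos : ∀ᵐ K ∂(ν : Measure (NonemptyCompacts ℂ)), 0 < conformalRadius ((K : NonemptyCompacts ℂ) : Set ℂ))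
    (hsnd : ∀ θ ∈ Ioo 0 (2 * Real.pi),
      (μ θ : Measure (NonemptyCompacts ℂ × NonemptyCompacts ℂ)).map Prod.snd = ν)
    (hsub : ∀ θ ∈ Ioo 0 (2 * Real.pi), ∀ᵐ p ∂(μ θ : Measure (NonemptyCompacts ℂ × NonemptyCompacts ℂ)),
      ((p.1 : NonemptyCompacts ℂ) : Set ℂ) ⊆ (p.2 : Set ℂ))
    (h210 : ∀ θ ∈ Ioo 0 (2 * Real.pi), ∀ s : ℝ,
      (μ θ : Measure (NonemptyCompacts ℂ × NonemptyCompacts ℂ)).real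
          {p | conformalRadius ((p.1 : NonemptyCompacts ℂ) : Set ℂ) ≤ Real.exp (-s)} =
        renewalST 6 bottomDatum (fun s ↦ (ν : Measure (NonemptyCompacts ℂ)).real
          {K | conformalRadius (K : Set ℂ) ≤ Real.exp (-s)}) θ s)
    {ζ : ℂ} (hζ : 1 ≤ ‖ζ‖) {θ₁ c γ : ℝ} (hθ₁ : θ₁ < 2 * Real.pi) (hγ : 1 / 2 < γ)
    (htail : ∀ θ ∈ Ioo θ₁ (2 * Real.pi), ∀ r : ℝ, 0 < r →
      (μ θ : Measure (NonemptyCompacts ℂ × NonemptyCompacts ℂ)).real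
          {p | ¬ (((p.2 : NonemptyCompacts ℂ) : Set ℂ) ⊆ (p.1 : Set ℂ) ∪ closedBall ζ r)} ≤
        c * ((2 * Real.pi - θ) / r) ^ γ)
    {t : ℝ} (ht : 0 < t) :
    lswHit 6 (2 * Real.pi) t =
      (ν : Measure (NonemptyCompacts ℂ)).real {K | conformalRadius (K : Set ℂ) ≤ Real.exp (-t)} := by
  obtain ⟨hdom, hfl⟩ := renewal_hypotheses_of_arcCoupling_linear ν μ hpos hsnd hsub h210 hζ hθ₁ hγ htail
  exact lswHit_two_pi_eq_measureReal_of_renewal ν hdom hfl ht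

end Coupling

/-- **`LawlerSchrammWerner2002_hittingPDE`, LSW Thm. 1.2 and Thm. 1.1 from arc couplings with tail
exponent `γ > 1/2` at the subsequential weak limits.** If every weak limit `ν` of `lswLaw (R_k)`,
`R_k → ∞`, has `𝔯 > 0` a.s. and admits, for `θ ∈ (0, 2π)`, couplings `μ_θ` of `(K_θ, K_{2π})` with
second marginal `ν`, `K_θ ⊆ K_{2π}` a.s., LSW's (2.10) for the first marginal, and a tail
`μ_θ{K_{2π} ⊄ K_θ ∪ B̄(ζ, r)} ≤ c ((2π - θ)/r)^γ` (`|ζ| ≥ 1`, `γ > 1/2`, `θ` near `2π`, `r > 0`), then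
`LawlerSchrammWerner2002_hittingPDE`, `LawlerSchrammWerner2002_scalingLimitExponent` and
`oneArm_exponent` hold (`oneArm_exponent_of_subseqRenewal`).
[cite: LawlerSchrammWernerEJP2002, Thm. 1.1, Thm. 1.2, §2 (Thm. 2.1, (2.10), Lemma 2.3)] -/
theorem oneArm_exponent_of_subseqArcCoupling_linear
    (h : ∀ (R : ℕ → ℝ) (ν : ProbabilityMeasure (NonemptyCompacts ℂ)),
      Tendsto R atTop atTop → Tendsto (lswLaw ∘ R) atTop (𝓝 ν) →
      (∀ᵐ K ∂(ν : Measure (NonemptyCompacts ℂ)), 0 < conformalRadius ((K : NonemptyCompacts ℂ) : Set ℂ)) ∧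
      ∃ μ : ℝ → ProbabilityMeasure (NonemptyCompacts ℂ × NonemptyCompacts ℂ),
        (∀ θ ∈ Ioo 0 (2 * Real.pi),
          (μ θ : Measure (NonemptyCompacts ℂ × NonemptyCompacts ℂ)).map Prod.snd = ν) ∧
        (∀ θ ∈ Ioo 0 (2 * Real.pi), ∀ᵐ p ∂(μ θ : Measure (NonemptyCompacts ℂ × NonemptyCompacts ℂ)),
          ((p.1 : NonemptyCompacts ℂ) : Set ℂ) ⊆ (p.2 : Set ℂ)) ∧
        (∀ θ ∈ Ioo 0 (2 * Real.pi), ∀ s : ℝ,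
          (μ θ : Measure (NonemptyCompacts ℂ × NonemptyCompacts ℂ)).real
              {p | conformalRadius ((p.1 : NonemptyCompacts ℂ) : Set ℂ) ≤ Real.exp (-s)} =
            renewalST 6 bottomDatum (fun s ↦ (ν : Measure (NonemptyCompacts ℂ)).real
              {K | conformalRadius (K : Set ℂ) ≤ Real.exp (-s)}) θ s) ∧
        ∃ (ζ : ℂ) (θ₁ c γ : ℝ), 1 ≤ ‖ζ‖ ∧ θ₁ < 2 * Real.pi ∧ 1 / 2 < γ ∧
          ∀ θ ∈ Ioo θ₁ (2 * Real.pi), ∀ r : ℝ, 0 < r →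
            (μ θ : Measure (NonemptyCompacts ℂ × NonemptyCompacts ℂ)).real
                {p | ¬ (((p.2 : NonemptyCompacts ℂ) : Set ℂ) ⊆ (p.1 : Set ℂ) ∪ closedBall ζ r)} ≤
              c * ((2 * Real.pi - θ) / r) ^ γ) :
    LawlerSchrammWerner2002_hittingPDE ∧ LawlerSchrammWerner2002_scalingLimitExponent ∧ oneArm_exponent := by
  refine oneArm_exponent_of_subseqRenewal fun R ν hR hν ↦ ?_
  obtain ⟨hpos, μ, hsnd, hsub, h210, ζ, θ₁, c, γ, hζ, hθ₁, hγ, htail⟩ := h R ν hR hν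
  exact renewal_hypotheses_of_arcCoupling_linear ν μ hpos hsnd hsub h210 hζ hθ₁ hγ htail

/-- **`oneArm_exponent_of_subseqArcCoupling_linear` with `𝔯 > 0` a.s. discharged** (RSW,
`ae_conformalRadius_pos_of_subseqLimit`): the three LSW facts follow from the existence, at every
subsequential weak limit of `lswLaw`, of arc couplings with LSW's (2.10) for the first marginal and a
tail of exponent `γ > 1/2` localised at some `|ζ| ≥ 1` — what the half-plane two-arm bound gives
for the discrete arc hulls. [cite: LawlerSchrammWernerEJP2002, Thm. 1.1, Thm. 1.2, §2 (Thm. 2.1, (2.10), Lemma 2.3)] -/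
theorem oneArm_exponent_of_subseqArcCoupling_linear'
    (h : ∀ (R : ℕ → ℝ) (ν : ProbabilityMeasure (NonemptyCompacts ℂ)),
      Tendsto R atTop atTop → Tendsto (lswLaw ∘ R) atTop (𝓝 ν) →
      ∃ μ : ℝ → ProbabilityMeasure (NonemptyCompacts ℂ × NonemptyCompacts ℂ),
        (∀ θ ∈ Ioo 0 (2 * Real.pi),
          (μ θ : Measure (NonemptyCompacts ℂ × NonemptyCompacts ℂ)).map Prod.snd = ν) ∧
        (∀ θ ∈ Ioo 0 (2 * Real.pi), ∀ᵐ p ∂(μ θ : Measure (NonemptyCompacts ℂ × NonemptyCompacts ℂ)),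
          ((p.1 : NonemptyCompacts ℂ) : Set ℂ) ⊆ (p.2 : Set ℂ)) ∧
        (∀ θ ∈ Ioo 0 (2 * Real.pi), ∀ s : ℝ,
          (μ θ : Measure (NonemptyCompacts ℂ × NonemptyCompacts ℂ)).real
              {p | conformalRadius ((p.1 : NonemptyCompacts ℂ) : Set ℂ) ≤ Real.exp (-s)} =
            renewalST 6 bottomDatum (fun s ↦ (ν : Measure (NonemptyCompacts ℂ)).real
              {K | conformalRadius (K : Set ℂ) ≤ Real.exp (-s)}) θ s) ∧
        ∃ (ζ : ℂ) (θ₁ c γ : ℝ), 1 ≤ ‖ζ‖ ∧ θ₁ < 2 * Real.pi ∧ 1 / 2 < γ ∧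
          ∀ θ ∈ Ioo θ₁ (2 * Real.pi), ∀ r : ℝ, 0 < r →
            (μ θ : Measure (NonemptyCompacts ℂ × NonemptyCompacts ℂ)).real
                {p | ¬ (((p.2 : NonemptyCompacts ℂ) : Set ℂ) ⊆ (p.1 : Set ℂ) ∪ closedBall ζ r)} ≤
              c * ((2 * Real.pi - θ) / r) ^ γ) :
    LawlerSchrammWerner2002_hittingPDE ∧ LawlerSchrammWerner2002_scalingLimitExponent ∧ oneArm_exponent :=
  oneArm_exponent_of_subseqArcCoupling_linear fun R ν hR hν ↦
    ⟨ae_conformalRadius_pos_of_subseqLimit R ν hR hν, h R ν hR hν⟩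

end Literature.Probability.Percolation
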